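import Summits.PneNP.PneNP.Theorems.SupportRectangleBlockLift
import Literature.Barriers.PneNP.TSPExtensionComplexityRothvossKernel
import HarnessLib

/-!
# Robustness of the small-block psd bound under perturbations OFF the support (papers lane, 2026-08-27)

The block-psd lower bound for the matching polytope (`SmallBlockRothvossBallGrid.block_core`,
`SupportRectangleBlockLift.blockBound_supp`) consumes Rothvoß's weight datum only through `⟨W, S⟩ = 1`, the
all-rectangle bound and the dominating kernel. Off the tight pairs Rothvoß's weight is `W = K − K₂` with
`K, K₂ ≥ 0`, `Σ K ≤ 1`, `Σ K₂ ≤ 1/74` (`Literature.Barriers.PneNP.exists_WK2_fin`), so `⟨W, S'⟩ ≥ 1/2` for every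
matrix `S'` that vanishes where `S` does and is within `1/4` of `S` elsewhere; normalising by `⟨W, S'⟩`
re-enters `blockBound_supp`. Results:

* `blockBound_perturbed` — ABSTRACT: the hypotheses of `blockBound_supp` for `S` (all rectangles), a second
  kernel `K₂` with `W = K − K₂` off the zeros of `S`, and ANY `S'` with `S' = 0` on the zeros of `S`,
  `|S' − S| ≤ 1/4`: every `(S^b_+)^m` factorization of `S'` obeys `(2/θ₀)^{1/(b+1)} ≤ m · 388800 b⁵ Δ³`;
* `block_core_robust` — at Rothvoß's slot sizes: every `(S^b_+)^r` factorization of such a perturbation `S'`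
  of the `t`-cut slack matrix obeys `2^{δ_R m/(b+1)} ≤ r · 388800 b⁵ (t−1)³` (cf. `block_core`:
  `14400` for `S` itself).

Purpose (papers-lane draft «Small-block psd lifts of the perfect matching polytope», §7): by
Kaniewski–Lee–de Wolf [cite: KaniewskiLeeDewolf2015, Thm. 19] the slack matrix has such a perturbation `S̃`
(exact on all entries `≤ (n/2)^{2ε}`, within `2^{-(n/2)^{2ε}}` elsewhere) of psd rank `2^{O(n^{1/2+ε} log² n)}`;
since the formalised argument applies to `S̃` verbatim, no argument with this robustness forces a block
larger than `2^{Õ(√n)}` for polynomially many blocks. WHAT THIS IS NOT: no statement about general psd rank;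
nothing P-vs-NP-relevant; the transfer from slot sizes to all even `n` (faces) is not repeated here.
-/

set_option linter.dupNamespace false -- `Summit.PneNP.PneNP.…`: summit = sub-problem (D-0017)

noncomputable section

open scoped Classical MatrixOrder

open Finset Real Matrix Literature.Barriers.PneNP

namespace Summit.PneNP.PneNP.Theorems.SupportRectangleBlockLift

/-- **Abstract robustness off the support.** Let `S ≤ Δ` (`Δ ≥ 2`) carry a weight datum `W ≤ K`, `K ≥ 0`,
`ΣK ≤ 1`, `⟨W, S⟩ = 1`, all rectangle sums `≤ θ₀` (`θ₀ > 0`), and a second kernel `K₂ ≥ 0`, `ΣK₂ ≤ 1`, with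
`W = K − K₂` wherever `S ≠ 0`. Then for every `S'` with `S' = 0` on the zeros of `S` and `|S' − S| ≤ 1/4`
entrywise, every `(S^b_+)^m` factorization of `S'` (`b ≥ 1`) satisfies
`(2/θ₀)^{1/(b+1)} ≤ m · 388800 b⁵ Δ³`. Proof: `s = ⟨W, S'⟩ ∈ [1/2, 3/2]` since
`|⟨W, S' − S⟩| ≤ (ΣK + ΣK₂)/4`; apply `blockBound_supp` to `S'/s ≤ 3Δ` with the same `W, K`. -/
theorem blockBound_perturbed {α β : Type} [Fintype α] [Fintype β] (S S' W K K₂ : α → β → ℝ) {Δ θ₀ : ℝ}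
    (hΔ2 : 2 ≤ Δ) (hθ0 : 0 < θ₀) (hSΔ : ∀ x y, S x y ≤ Δ)
    (hK0 : ∀ x y, 0 ≤ K x y) (hWK : ∀ x y, W x y ≤ K x y) (hKsum : ∑ x, ∑ y, K x y ≤ 1)
    (hK20 : ∀ x y, 0 ≤ K₂ x y) (hK2sum : ∑ x, ∑ y, K₂ x y ≤ 1)
    (hWeq : ∀ x y, S x y ≠ 0 → W x y = K x y - K₂ x y)
    (hWS : ∑ x, ∑ y, W x y * S x y = 1)
    (hrect : ∀ (X : Finset α) (Y : Finset β), ∑ x ∈ X, ∑ y ∈ Y, W x y ≤ θ₀)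
    (hS'0 : ∀ x y, S x y = 0 → S' x y = 0) (hS'S : ∀ x y, |S' x y - S x y| ≤ 1 / 4)
    {b m : ℕ} (hb : 1 ≤ b) (A : α → Fin m → Matrix (Fin b) (Fin b) ℝ)
    (B : β → Fin m → Matrix (Fin b) (Fin b) ℝ)
    (hA : ∀ x i, (A x i).PosSemidef) (hB : ∀ y i, (B y i).PosSemidef)
    (hfac : ∀ x y, S' x y = ∑ i, (A x i * B y i).trace) :
    (2 / θ₀) ^ ((1 : ℝ) / (b + 1)) ≤ m * (388800 * (b : ℝ) ^ 5 * Δ ^ 3) := by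
  -- the normalisation `s = ⟨W, S'⟩ ∈ [1/2, 3/2]`
  set s : ℝ := ∑ x, ∑ y, W x y * S' x y with hs
  have hpt : ∀ x y, |W x y * (S' x y - S x y)| ≤ K x y / 4 + K₂ x y / 4 := by
    intro x y
    by_cases h0 : S x y = 0
    · rw [hS'0 x y h0, h0, sub_zero, mul_zero, abs_zero]
      have := hK0 x y
      have := hK20 x y
      positivity
    · rw [abs_mul, hWeq x y h0]
      have h1 : |K x y - K₂ x y| ≤ K x y + K₂ x y :=
        abs_sub_le_iff.2 ⟨by linarith [hK20 x y], by linarith [hK0 x y]⟩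
      have h2 := mul_le_mul h1 (hS'S x y) (abs_nonneg _) (add_nonneg (hK0 x y) (hK20 x y))
      linarith
  have hdiff : |s - 1| ≤ 1 / 2 := by
    have hs1 : s - 1 = ∑ x, ∑ y, W x y * (S' x y - S x y) := by
      rw [hs, ← hWS, ← Finset.sum_sub_distrib]
      refine sum_congr rfl fun x _ => ?_
      rw [← Finset.sum_sub_distrib]
      refine sum_congr rfl fun y _ => ?_
      ring
    rw [hs1]
    calc |∑ x, ∑ y, W x y * (S' x y - S x y)|
        ≤ ∑ x, |∑ y, W x y * (S' x y - S x y)| := abs_sum_le_sum_abs _ _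
      _ ≤ ∑ x, ∑ y, |W x y * (S' x y - S x y)| := sum_le_sum fun x _ => abs_sum_le_sum_abs _ _
      _ ≤ ∑ x, ∑ y, (K x y / 4 + K₂ x y / 4) := sum_le_sum fun x _ => sum_le_sum fun y _ => hpt x y
      _ = (∑ x, ∑ y, K x y) / 4 + (∑ x, ∑ y, K₂ x y) / 4 := by
          simp only [Finset.sum_add_distrib, ← Finset.sum_div]
      _ ≤ 1 / 2 := by linarith
  have hs_half : 1 / 2 ≤ s := by
    have := (abs_le.mp hdiff).1
    linarith
  have hs_pos : 0 < s := by linarith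
  have hs0 : 0 ≤ 1 / s := by positivity
  -- the normalised matrix `S'/s ≤ 3Δ` and its factorization
  have hΔ0 : 0 ≤ Δ := by linarith
  have hSΔ' : ∀ x y, S' x y / s ≤ 3 * Δ := by
    intro x y
    rw [div_le_iff₀ hs_pos]
    have h1 : S' x y ≤ Δ + 1 / 4 := by
      have := (abs_le.mp (hS'S x y)).2
      linarith [hSΔ x y]
    nlinarith
  have hWS' : ∑ x, ∑ y, W x y * (S' x y / s) = 1 := by
    have : ∀ x y, W x y * (S' x y / s) = W x y * S' x y / s := fun x y => (mul_div_assoc _ _ _).symm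
    simp only [this, ← Finset.sum_div]
    rw [← hs]
    exact div_self hs_pos.ne'
  have hfac' : ∀ x y, S' x y / s = ∑ i, ((1 / s) • A x i * B y i).trace := by
    intro x y
    simp only [Matrix.smul_mul, Matrix.trace_smul, smul_eq_mul, ← Finset.mul_sum, ← hfac x y]
    ring
  have key := blockBound_supp (fun x y => S' x y / s) W K (Δ := 3 * Δ) (θ₀ := θ₀) (by linarith) hθ0
    hSΔ' hK0 hWK hKsum hWS' (fun X Y _ => hrect X Y) hb (fun x i => (1 / s) • A x i) B
    (fun x i => (hA x i).smul hs0) hB hfac'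
  calc (2 / θ₀) ^ ((1 : ℝ) / (b + 1)) ≤ m * (14400 * (b : ℝ) ^ 5 * (3 * Δ) ^ 3) := key
    _ = m * (388800 * (b : ℝ) ^ 5 * Δ ^ 3) := by ring

/-- **The block bound at Rothvoß's slot sizes is robust to perturbations off the support.** For
`m = 2μ+1` large and `n = |Slot m 72|`, `t = tCut 72 μ`: if `S'` agrees with the `t`-cut slack matrix
`S = |δ(U) ∩ M| − 1` of `P_PM(n)` on the zeros of `S` (the tight pairs) and `|S' − S| ≤ 1/4` elsewhere, then
every writing of `S'` as a sum of `r` pairings of psd `b × b` blocks (`b ≥ 1`) has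
`2^{δ_R m/(b+1)} ≤ r · 388800 b⁵ (t − 1)³`. (The formalised small-block argument cannot distinguish `S`
from such an `S'`; by [cite: KaniewskiLeeDewolf2015, Thm. 19] one such `S'` has a single psd block of size
`2^{O(n^{1/2+ε} log² n)}`.) -/
theorem block_core_robust (μ : ℕ) {m : ℕ} (hm : m = 2 * μ + 1)
    (hU1 : (64 / cU εR) ^ 2 ≤ (m : ℝ) + 1) (hU2 : 32 / cU εR ≤ (m : ℝ) + 1)
    (hM1 : 16 * FQ * Real.log QB / cM qR εR ≤ (m : ℝ)) {b r : ℕ} (hb : 1 ≤ b)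
    (S' : {U : Finset (Fin (Fintype.card (Slot m qR))) // U.card = tCut qR μ} →
      {M : Finset (Sym2 (Fin (Fintype.card (Slot m qR)))) // IsPMOn univ M} → ℝ)
    (hS'0 : ∀ (a : {U : Finset (Fin (Fintype.card (Slot m qR))) // U.card = tCut qR μ})
      (c : {M : Finset (Sym2 (Fin (Fintype.card (Slot m qR)))) // IsPMOn univ M}),
      ((c.1.filter (fun f => cutCount a.1 f = 1)).card : ℝ) - 1 = 0 → S' a c = 0)
    (hS'S : ∀ (a : {U : Finset (Fin (Fintype.card (Slot m qR))) // U.card = tCut qR μ})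
      (c : {M : Finset (Sym2 (Fin (Fintype.card (Slot m qR)))) // IsPMOn univ M}),
      |S' a c - (((c.1.filter (fun f => cutCount a.1 f = 1)).card : ℝ) - 1)| ≤ 1 / 4)
    (A : {U : Finset (Fin (Fintype.card (Slot m qR))) // U.card = tCut qR μ} →
      Fin r → Matrix (Fin b) (Fin b) ℝ)
    (B : {M : Finset (Sym2 (Fin (Fintype.card (Slot m qR)))) // IsPMOn univ M} →
      Fin r → Matrix (Fin b) (Fin b) ℝ)
    (hA : ∀ a i, (A a i).PosSemidef) (hB : ∀ b i, (B b i).PosSemidef)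
    (hfac : ∀ a c, S' a c = ∑ i, (A a i * B c i).trace) :
    (2 : ℝ) ^ (δR * m / (b + 1)) ≤ r * (388800 * (b : ℝ) ^ 5 * ((tCut qR μ : ℝ) - 1) ^ 3) := by
  obtain ⟨W, K, K₂, hrect, hWS, hWK, hK0, hKsum, hK20, hK2sum, hWeq⟩ := exists_WK2_fin μ hm hU1 hU2 hM1
  -- parameters
  have ht3 : 3 ≤ tCut qR μ := by unfold tCut; omega
  have hΔ2 : (2 : ℝ) ≤ (tCut qR μ : ℝ) - 1 := by
    have : (3 : ℝ) ≤ (tCut qR μ : ℝ) := by exact_mod_cast ht3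
    linarith
  have hθ0 : 0 < 2 * θR m := mul_pos two_pos (θR_pos m)
  -- the slack matrix `S ≤ t − 1`
  have hSΔ : ∀ (a : {U : Finset (Fin (Fintype.card (Slot m qR))) // U.card = tCut qR μ})
      (c : {M : Finset (Sym2 (Fin (Fintype.card (Slot m qR)))) // IsPMOn univ M}),
      ((c.1.filter (fun f => cutCount a.1 f = 1)).card : ℝ) - 1 ≤ (tCut qR μ : ℝ) - 1 := by
    intro a c
    have h1 := c.2.card_cut_le (subset_univ a.1)
    rw [a.2] at h1
    have h2 : (((c.1.filter (fun f => cutCount a.1 f = 1)).card : ℕ) : ℝ) ≤ (tCut qR μ : ℝ) := by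
      exact_mod_cast h1
    linarith
  have hWeq' : ∀ (a : {U : Finset (Fin (Fintype.card (Slot m qR))) // U.card = tCut qR μ})
      (c : {M : Finset (Sym2 (Fin (Fintype.card (Slot m qR)))) // IsPMOn univ M}),
      ((c.1.filter (fun f => cutCount a.1 f = 1)).card : ℝ) - 1 ≠ 0 → W a c = K a c - K₂ a c := by
    intro a c h
    refine hWeq a c fun h1 => h ?_
    rw [h1]
    norm_num
  have h74 : ∑ a, ∑ c, K₂ a c ≤ 1 := hK2sum.trans (by norm_num)
  have key := blockBound_perturbed
    (fun a c => ((c.1.filter (fun f => cutCount a.1 f = 1)).card : ℝ) - 1) S' W K K₂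
    (Δ := (tCut qR μ : ℝ) - 1) (θ₀ := 2 * θR m) hΔ2 hθ0 hSΔ hK0 hWK hKsum hK20 h74 hWeq' hWS hrect hS'0 hS'S
    hb A B hA hB hfac
  -- `(2/(2θ_R))^{1/(b+1)} = 2^{δ_R m/(b+1)}`
  have hpow : (0 : ℝ) < (2 : ℝ) ^ (δR * m) := Real.rpow_pos_of_pos (by norm_num) _
  have h2 : 2 / (2 * θR m) = (2 : ℝ) ^ (δR * m) := by
    have hθ : θR m = ((2 : ℝ) ^ (δR * m))⁻¹ := by
      unfold θR
      rw [Real.rpow_neg (by norm_num : (0 : ℝ) ≤ 2)]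
    rw [hθ]
    field_simp
  have hconv : (2 / (2 * θR m)) ^ ((1 : ℝ) / (b + 1)) = (2 : ℝ) ^ (δR * m / (b + 1)) := by
    rw [h2, ← Real.rpow_mul (by norm_num : (0 : ℝ) ≤ 2)]
    congr 1
    ring
  rw [← hconv]
  exact key

open Literature.Combinatorics.Optimization in
/-- **Robust explicit fixed-block bound for `P_PM(n)`, all even `n`.** There is `n₀` (Rothvoß's largeness
thresholds, as in `SmallBlockRothvossBallGrid.blockPsd_explicit`) such that for all even `n ≥ n₀`, all
`b ≥ 1`, all `m`, and every real matrix `S'` on (odd vertex sets) × (perfect matchings of `K_n`) which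
VANISHES wherever the odd-cut slack `pmSlack U M = |δ(U) ∩ M| − 1` does and satisfies `|S' − pmSlack| ≤ 1/4`
elsewhere: if `S' U M = Σ_i Tr(A_i(M) B_i(U))` with real psd `b × b` blocks, then
`2^{δ_R n/(798(b+1))} ≤ m · 388800 b⁵ n³`. Proof: restrict to the face `P_PM(N)`, `N = 216(2μ+1)+150 ≤ n`,
with the cell's `SmallBlockRothvoss.liftPM` (both hypotheses on `S'` survive because the cut count does,
`card_cut_liftPM`), then `block_core_robust` and the arithmetic of `blockPsd_explicit`. This is the
statement the papers-lane draft pairs with [cite: KaniewskiLeeDewolf2015, Thm. 19]. -/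
theorem blockPsd_explicit_robust : ∃ n₀ : ℕ, ∀ n : ℕ, n₀ ≤ n → Even n → ∀ b m : ℕ, 1 ≤ b →
    ∀ (S' : Finset (Fin n) → Finset (Sym2 (Fin n)) → ℝ)
      (A : Finset (Sym2 (Fin n)) → Fin m → Matrix (Fin b) (Fin b) ℝ)
      (B : Finset (Fin n) → Fin m → Matrix (Fin b) (Fin b) ℝ),
      (∀ M i, IsPMOn (univ : Finset (Fin n)) M → (A M i).PosSemidef) →
      (∀ U i, Odd U.card → (B U i).PosSemidef) →
      (∀ U M, Odd U.card → IsPMOn (univ : Finset (Fin n)) M → pmSlack U M = 0 → S' U M = 0) →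
      (∀ U M, Odd U.card → IsPMOn (univ : Finset (Fin n)) M → |S' U M - pmSlack U M| ≤ 1 / 4) →
      (∀ U M, Odd U.card → IsPMOn (univ : Finset (Fin n)) M → S' U M = ∑ i, (A M i * B U i).trace) →
      (2 : ℝ) ^ (δR * n / (798 * (b + 1))) ≤ m * (388800 * (b : ℝ) ^ 5 * (n : ℝ) ^ 3) := by
  have hδ := δR_pos
  set T : ℝ := max (798 * ((64 / cU εR) ^ 2)) (max (798 * (32 / cU εR))
    (798 * (16 * FQ * Real.log QB / cM qR εR))) with hT
  refine ⟨max 1000 ⌈T⌉₊, fun n hn heven b r hb S' A B hA hB hS'0 hS'S hfac => ?_⟩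
  have hn1000 : 1000 ≤ n := le_trans (le_max_left _ _) hn
  have hnT : T ≤ (n : ℝ) := (Nat.le_ceil T).trans (by exact_mod_cast le_trans (le_max_right _ _) hn)
  have hT1 : 798 * ((64 / cU εR) ^ 2) ≤ (n : ℝ) := le_trans (le_max_left _ _) hnT
  have hT2 : 798 * (32 / cU εR) ≤ (n : ℝ) := le_trans (le_trans (le_max_left _ _) (le_max_right _ _)) hnT
  have hT3 : 798 * (16 * FQ * Real.log QB / cM qR εR) ≤ (n : ℝ) :=
    le_trans (le_trans (le_max_right _ _) (le_max_right _ _)) hnT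
  -- the parameters
  set μ : ℕ := (n - 366) / 432 with hμ
  set m : ℕ := 2 * μ + 1 with hm
  have hdiv : n - 366 < 432 * (μ + 1) := by
    have := Nat.lt_div_mul_add (a := n - 366) (b := 432) (by norm_num)
    rw [hμ]; linarith
  have hle : 432 * μ ≤ n - 366 := by rw [hμ]; exact Nat.mul_div_le _ _ |>.trans' (by rw [Nat.mul_comm])
  have hmn : n ≤ 798 * m := by omega
  have hmR : (n : ℝ) ≤ 798 * (m : ℝ) := by exact_mod_cast hmn
  have h798 : (0 : ℝ) < 798 := by norm_num
  -- the largeness hypotheses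
  have hA1 : (64 / cU εR) ^ 2 ≤ (m : ℝ) := le_of_mul_le_mul_left (hT1.trans hmR) h798
  have hA2 : 32 / cU εR ≤ (m : ℝ) := le_of_mul_le_mul_left (hT2.trans hmR) h798
  have hA3 : 16 * FQ * Real.log QB / cM qR εR ≤ (m : ℝ) := le_of_mul_le_mul_left (hT3.trans hmR) h798
  have hm1 : (m : ℝ) ≤ (m : ℝ) + 1 := by linarith
  -- the slot size
  set N : ℕ := Fintype.card (Slot m qR) with hNdef
  have hN' : N = 432 * μ + 366 := by rw [hNdef, Slot.card, hm]; unfold qR; ring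
  have hNn : N ≤ n := by omega
  have hevenN : Even N := ⟨216 * μ + 183, by rw [hN']; ring⟩
  have hevenD : Even (n - N) := (Nat.even_sub hNn).2 ⟨fun _ => hevenN, fun _ => heven⟩
  -- the face `P_PM(N)`: a perfect matching `M₀` of the last `n − N` vertices
  obtain ⟨M₀, hM₀⟩ :=
    exists_isPMOn_of_even (n - N) (SmallBlockRothvoss.rest hNn) (SmallBlockRothvoss.card_rest hNn) hevenD
  have ht : Odd (tCut qR μ) := by
    unfold tCut qR
    exact Even.add_odd (Even.mul_left (by decide) _) (by decide)
  -- the data transported to the face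
  have hodd : ∀ a : {U : Finset (Fin N) // U.card = tCut qR μ},
      Odd (a.1.map (SmallBlockRothvoss.emb hNn)).card := fun a => by rw [card_map, a.2]; exact ht
  have hpm : ∀ c : {M : Finset (Sym2 (Fin N)) // IsPMOn univ M},
      IsPMOn univ (SmallBlockRothvoss.liftPM hNn M₀ c.1) := fun c =>
    SmallBlockRothvoss.liftPM_isPMOn hNn hM₀ c.2
  have hslackN : ∀ (a : {U : Finset (Fin N) // U.card = tCut qR μ})
      (c : {M : Finset (Sym2 (Fin N)) // IsPMOn univ M}),
      pmSlack (a.1.map (SmallBlockRothvoss.emb hNn)) (SmallBlockRothvoss.liftPM hNn M₀ c.1) =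
        ((c.1.filter (fun f => cutCount a.1 f = 1)).card : ℝ) - 1 := fun a c => by
    unfold pmSlack
    rw [SmallBlockRothvoss.card_cut_liftPM hNn hM₀]
  have key := block_core_robust μ hm (hA1.trans hm1) (hA2.trans hm1) hA3 hb
    (fun a c => S' (a.1.map (SmallBlockRothvoss.emb hNn)) (SmallBlockRothvoss.liftPM hNn M₀ c.1))
    (fun a c h0 => hS'0 _ _ (hodd a) (hpm c) (by rw [hslackN a c]; exact h0))
    (fun a c => by rw [← hslackN a c]; exact hS'S _ _ (hodd a) (hpm c))
    (fun a i => B (a.1.map (SmallBlockRothvoss.emb hNn)) i)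
    (fun c i => A (SmallBlockRothvoss.liftPM hNn M₀ c.1) i)
    (fun a i => hB _ i (hodd a)) (fun c i => hA _ i (hpm c))
    (fun a c => by
      rw [hfac _ _ (hodd a) (hpm c)]
      exact sum_congr rfl fun i _ => Matrix.trace_mul_comm _ _)
  -- sizes: `t - 1 ≤ n`, `n ≤ 798 m`
  have htn : (tCut qR μ : ℝ) - 1 ≤ n := by
    have : tCut qR μ ≤ n := by unfold tCut qR; omega
    have : (tCut qR μ : ℝ) ≤ n := by exact_mod_cast this
    linarith
  have ht0 : (0 : ℝ) ≤ (tCut qR μ : ℝ) - 1 := by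
    have : (1 : ℝ) ≤ tCut qR μ := by exact_mod_cast ht.pos
    linarith
  have hb1 : (0 : ℝ) < (b : ℝ) + 1 := by positivity
  have hexp : δR * n / (798 * (b + 1)) ≤ δR * m / (b + 1) := by
    rw [div_le_div_iff₀ (by positivity) hb1]
    have h1 : δR * n ≤ δR * (798 * m) := mul_le_mul_of_nonneg_left hmR hδ.le
    calc δR * n * ((b : ℝ) + 1) ≤ δR * (798 * m) * ((b : ℝ) + 1) := mul_le_mul_of_nonneg_right h1 hb1.le
      _ = δR * m * (798 * ((b : ℝ) + 1)) := by ring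
  calc (2 : ℝ) ^ (δR * n / (798 * (b + 1))) ≤ (2 : ℝ) ^ (δR * m / (b + 1)) :=
        Real.rpow_le_rpow_of_exponent_le (by norm_num) hexp
    _ ≤ r * (388800 * (b : ℝ) ^ 5 * ((tCut qR μ : ℝ) - 1) ^ 3) := key
    _ ≤ r * (388800 * (b : ℝ) ^ 5 * (n : ℝ) ^ 3) :=
        mul_le_mul_of_nonneg_left (mul_le_mul_of_nonneg_left (pow_le_pow_left₀ ht0 htn 3)
          (by positivity)) (Nat.cast_nonneg r)


end Summit.PneNP.PneNP.Theorems.SupportRectangleBlockLift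

end
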